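import Literature.AnabelianGeometry.AbsoluteAnabelian.IdRigidEpiCoverDescent
import Literature.AnabelianGeometry.AbsoluteAnabelian.ArchimedeanHolFieldFunctorGeometricCovFin
import Literature.AnabelianGeometry.AbsoluteAnabelian.ArchimedeanHolFieldFunctorGeometricOverIdRigidInstances
import Literature.Topology.CoveringSpaces.CoveringGaloisObjects
import Literature.AnabelianGeometry.Anabelioids.TerminalCoproductComponents
import Mathlib.CategoryTheory.Galois.Decomposition
import HarnessLib

/-!
# [AbsTopIII] Prop. 4.2 (i) at the geometric model: Galois closure with epimorphisms in `HolRS`,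
# the epi-cover descent of id-rigidity instantiated, and the pull-back twist (row «H1PRIME-HOLRS»)

S. Mochizuki, *Topics in Absolute Anabelian Geometry III*, proof of Prop. 4.2 (i), kurims p.106
l.11–19: the id-rigidity of «the full subcategory of `EA` consisting of objects that map to `X`» comes
from the finite étale COVERINGS of `X` (slimness, Lemma 4.3) and is pushed down along the covering maps.
[cite: MochizukiAbsTopIII2015, Proposition 4.2 (i) p.106]

PROOF-ONLY file (abc-iut cell, seat abc-iut-w5-d144 gen 4, row «H1PRIME-HOLRS» of abc-iut-L4-lead's
RULING #8f (10); campaign-L R1.2, GAP row G-L4t14-R1): the instantiation at abc-iut-L4-t14's geometric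
model `HolRS` (connected Riemann surfaces, holomorphic finite étale maps) of abc-iut-w6-d003's abstract
descent `IdRigidEpiCoverDescent.lean`, written after the audit finding VACUITY-H1 (the per-object
hypothesis (H1) «an automorphism of `X` commuting with `End X` is trivial» FAILS at every once-punctured
elliptic curve).  Contents:

* §0 `isGalois_of_iso` — in any Galois category, Galois objects are stable under isomorphism
  (bookkeeping for the transport below; Mathlib states `IsGalois` but not this closure property).
* §1 (any category) `nonempty_overMap_iso_id` — **the pull-back twist**: an automorphism `α` of the
  identity functor of `{Y | Nonempty (Y ⟶ X)}` with `X`-component `σ` yields `Over.map σ ≅ 𝟭_{Over X}`;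
  hence `isIdRigid_mapsTo_of_over_of_twist`: «mapsTo `X`» is id-rigid from (H2) «`Over X` id-rigid» and
  (H1′) «an automorphism `σ` of `X` with `Over.map σ ≅ 𝟭_{Over X}` is trivial» — the honest per-object
  residual (the categorical face of «`σ_*` inner on `π̂₁` ⇒ `σ = 1`», cf. abc-iut-L6-t18's twisted
  natural families), replacing (H1).
* §2 `HolRS.Hom.surjective`, `HolRS.epi_of_hom` — every holomorphic finite étale map of connected Riemann
  surfaces is surjective, so EVERY morphism of `HolRS` is an epimorphism.
* §3 `HolRS.exists_galois_hom_over`, `HolRS.exists_galois_epi` — **Galois closure in `HolRS`**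
  (unconditional): every `𝕐 → 𝕏` receives a morphism over `𝕏` — an epimorphism — from a connected Riemann
  surface `ℤ → 𝕏` whose underlying finite cover is a GALOIS object of the Galois category
  `Cov^fin(𝕏^top)` (abc-iut-f-072's `CovFin.galoisCategory`; Mathlib's
  `exists_hom_from_galois_of_connected`; abc-iut-L4-t12's `Over 𝕏 ≌ {connected finite covers}`).
* §4 `HolRS.isIdRigid_mapsTo_of_isIdRigid_galois` — the descent INSTANTIATED: if the Galois coverings of
  `𝕏` span an id-rigid full subcategory of `HolRS` (hypothesis (T)), «mapsTo `𝕏`» is id-rigid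
  (abc-iut-w6-d003's `isIdRigid_mapsTo_of_epi_cover`, its covering hypothesis (E) discharged by §3).
* §5 `HolRS.isIdRigid_mapsTo_of_twist_of_center_eq_bot` / `_of_isSlimGroup` — the slice route at a
  connected Riemann surface: «mapsTo `𝕏`» is id-rigid from `Z(π̂₁(𝕏^top, x₀)) = 1` (resp. slimness) and
  (H1′).

HONEST SCOPE: (T) and (H1′) are NOT consequences of the slimness of `π̂₁(𝕏^top)` alone (both fail,
together with the conclusion, at `ℂˣ` or an elliptic curve; both involve `Aut 𝕏`); print obtains them
for hyperbolic `𝕏` from Lemma 4.3 applied to cores / «`Aut(𝕏) → Out(π̂₁)` injective», which is not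
formalised here.  Classical mathematics; no definition, no instance, no Prop-valued fact; nothing here
bears on [IUTchIII] Cor. 3.12; model ≠ reconstruction.

## References

* S. Mochizuki, *Topics in Absolute Anabelian Geometry III*, kurims ms, §0 p.27 (id-rigid), Def 4.1
  (iii) p.103, proof of Prop 4.2 (i) p.106 l.11–19, Lemma 4.3 p.106. [MochizukiAbsTopIII2015]
* A. Grothendieck, M. Raynaud, SGA 1, Exp. V §4–§5 (Galois objects, Galois closure). [SGA1]
-/

noncomputable section

open CategoryTheory CategoryTheory.PreGaloisCategory
open Literature.Topology.CoveringSpaces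
open Literature.AlgebraicGeometry.Frobenioids (IsSlimGroup)
open Literature.IUT.HodgeTheaters (profiniteCompletion)

universe v u

namespace Literature.AnabelianGeometry.AbsoluteAnabelian

/-! ### §0 Galois objects are stable under isomorphism (any Galois category) -/

section GaloisIso

variable {C : Type u} [Category.{v} C] [GaloisCategory C]

/-- In a Galois category, an object isomorphic to a Galois object is Galois (connectedness transports,
and the automorphism group acts transitively on the fibre of a fibre functor by conjugating with the
isomorphism). [cite: SGA1, Exp. V §5] -/
theorem isGalois_of_iso {A B : C} (i : A ≅ B) [hA : IsGalois A] : IsGalois B := by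
  let F := GaloisCategory.getFiberFunctor C
  haveI : IsConnected B := Literature.AnabelianGeometry.Anabelioids.isConnected_of_iso i
  rw [isGalois_iff_pretransitive F]
  refine ⟨fun x y => ?_⟩
  obtain ⟨σ, hσ⟩ := MulAction.exists_smul_eq (Aut A) (F.map i.inv x) (F.map i.inv y)
  refine ⟨i.conjAut σ, ?_⟩
  have hσ' : F.map σ.hom (F.map i.inv x) = F.map i.inv y := hσ
  change F.map (i.conjAut σ).hom x = y
  rw [Iso.conjAut_apply]
  simp only [Iso.trans_hom, Iso.symm_hom, F.map_comp, FintypeCat.comp_apply]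
  rw [hσ', ← FintypeCat.comp_apply (F.map i.inv) (F.map i.hom), ← F.map_comp, Iso.inv_hom_id,
    F.map_id, FintypeCat.id_apply]

end GaloisIso

/-! ### §1 Pull-back twists: an automorphism of `𝟭` on «objects mapping to `X`» makes the pull-back
along its `X`-component isomorphic to the identity of the slice (any category) -/

section Twist

variable {C : Type u} [Category.{v} C] (X : C)

/-- **The twist carried by an automorphism of `𝟭_{mapsTo X}`.**  For an automorphism `α` of the
identity functor of the full subcategory `{Y | Nonempty (Y ⟶ X)}` with `X`-component `σ := α_X ∈ Aut X`,
the components `α_Y` assemble to an isomorphism of functors `Over.map σ ≅ 𝟭_{Over X}` on the slice: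
naturality of `α` along `f : Y ⟶ X` reads `α_Y ≫ f = f ≫ σ`, i.e. `α_Y : (Y, f ≫ σ) ⟶ (Y, f)` is a
morphism over `X`.  (So `α_X = 𝟙` — hypothesis (H1⁎) of `isIdRigid_mapsTo_of_app_self_eq_id` — follows
from any statement killing automorphisms `σ` of `X` whose pull-back on the slice is isomorphic to the
identity; at a connected Riemann surface that is «`σ_*` inner on `π̂₁(X^top)` ⇒ `σ = 1`».)
[cite: MochizukiAbsTopIII2015, Proposition 4.2 (i) p.106] -/
theorem nonempty_overMap_iso_id
    (α : 𝟭 (ObjectProperty.FullSubcategory fun Y : C => Nonempty (Y ⟶ X)) ≅ 𝟭 _) :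
    Nonempty (Over.map (α.hom.app (mapsToSelf X)).hom ≅ 𝟭 (Over X)) := by
  refine ⟨NatIso.ofComponents
    (fun B => Over.isoMk ((ObjectProperty.ι _).mapIso (α.app ⟨B.left, ⟨B.hom⟩⟩)) ?_) ?_⟩
  · have h := α.hom.naturality (X := ⟨B.left, ⟨B.hom⟩⟩) (Y := mapsToSelf X)
      (ObjectProperty.homMk B.hom)
    have h' := congrArg InducedCategory.Hom.hom h
    simp only [Functor.id_obj, Functor.id_map, ObjectProperty.FullSubcategory.comp_hom,
      ObjectProperty.homMk_hom] at h'
    simpa using h'.symm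
  · intro B B' g
    ext
    have h := α.hom.naturality (X := ⟨B.left, ⟨B.hom⟩⟩) (Y := ⟨B'.left, ⟨B'.hom⟩⟩)
      (ObjectProperty.homMk g.left)
    have h' := congrArg InducedCategory.Hom.hom h
    simp only [Functor.id_obj, Functor.id_map, ObjectProperty.FullSubcategory.comp_hom,
      ObjectProperty.homMk_hom] at h'
    simp only [Functor.id_obj, Functor.id_map]
    exact h'

/-- **«Objects mapping to `X`» is id-rigid from (H2) + (H1′).**  (H2): the slice `Over X` is id-rigid;
(H1′): an automorphism `σ` of `X` whose pull-back functor on the slice is isomorphic to the identity,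
`Over.map σ ≅ 𝟭_{Over X}`, is trivial.  Then `{Y | Nonempty (Y ⟶ X)}` is id-rigid
(`nonempty_overMap_iso_id` feeds (H1′), which yields (H1⁎) of abc-iut-w6-d003's
`isIdRigid_mapsTo_of_app_self_eq_id`).  (H1′) is the honest per-object residual of the `EA` column:
unlike (H1) («`Z(Aut X) = 1`»-type) it holds at once-punctured elliptic curves and, like (H1), fails at
`ℂˣ` or an elliptic curve, where «mapsTo `X`» is NOT id-rigid.
[cite: MochizukiAbsTopIII2015, Proposition 4.2 (i) p.106] -/
theorem isIdRigid_mapsTo_of_over_of_twist (h2 : IsIdRigid (Over X))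
    (h1' : ∀ σ : X ≅ X, Nonempty (Over.map σ.hom ≅ 𝟭 (Over X)) → σ.hom = 𝟙 X) :
    IsIdRigid (ObjectProperty.FullSubcategory fun Y : C => Nonempty (Y ⟶ X)) :=
  isIdRigid_mapsTo_of_app_self_eq_id X
    (fun α => h1' ((ObjectProperty.ι _).mapIso (α.app (mapsToSelf X))) (nonempty_overMap_iso_id X α)) h2

end Twist

namespace HolRS

variable (X : HolRS)

/-! ### §2 Every morphism of `HolRS` is surjective, hence an epimorphism -/

/-- A holomorphic finite étale map of connected Riemann surfaces is SURJECTIVE: it is a covering map, so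
its image is open (local homeomorphism) and closed (a point with empty fibre has an evenly covered
neighbourhood with empty preimage), and non-empty (the source is connected).
[cite: MochizukiAbsTopIII2015, Definition 4.1 (iii) p.103] -/
theorem Hom.surjective {Y Z : HolRS} (h : Y ⟶ Z) : Function.Surjective h.toFun := by
  have hcov : IsCoveringMap h.toFun := h.isFiniteEtale.isCoveringMap
  have hclosed : IsClosed (Set.range h.toFun) := by
    rw [← isOpen_compl_iff, isOpen_iff_forall_mem_open]
    intro x hx
    obtain ⟨_, U, hxU, hU, -, H, -⟩ := hcov x
    refine ⟨U, fun y hy hy' => ?_, hU, hxU⟩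
    obtain ⟨e, rfl⟩ := hy'
    exact hx ⟨((H ⟨e, hy⟩).2 : h.toFun ⁻¹' {x}).1, ((H ⟨e, hy⟩).2 : h.toFun ⁻¹' {x}).2⟩
  have hclopen : IsClopen (Set.range h.toFun) :=
    ⟨hclosed, hcov.isLocalHomeomorph.isOpenMap.isOpen_range⟩
  rw [← Set.range_eq_univ]
  exact hclopen.eq_univ (Set.range_nonempty h.toFun)

/-- **Every morphism of `HolRS` is an epimorphism** (surjective on points, and morphisms are
determined by their underlying maps). [cite: MochizukiAbsTopIII2015, Definition 4.1 (iii) p.103] -/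
theorem epi_of_hom {Y Z : HolRS} (h : Y ⟶ Z) : Epi h :=
  ⟨fun u v huv => hom_ext (funext fun z => by
    obtain ⟨y, rfl⟩ := Hom.surjective h z
    exact congrFun (congrArg Hom.toFun huv) y)⟩

/-! ### §3 Galois closure in `HolRS`: every `𝕐 → 𝕏` is dominated by a Galois covering of `𝕏` -/

/-- The image of an object of the slice over `𝕏` in `Cov^fin(𝕏^top)` is a CONNECTED object of that
Galois category (its total space, a connected Riemann surface, is path connected).
[cite: MochizukiAbsTopIII2015, proof of Proposition 4.2, p.106 l.11–19] -/
theorem isConnected_overToCovFin_obj [GaloisCategory (CovFin X.carrier)] (Y : Over X) :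
    IsConnected (X.overToCovFin.obj Y) := by
  haveI := pathConnectedSpace_carrier X
  haveI := stronglyLocallyContractibleSpace_carrier X
  obtain ⟨x₀⟩ := (inferInstance : Nonempty X.carrier)
  rw [CovFin.isConnected_iff_pathConnectedSpace x₀]
  exact pathConnectedSpace_carrier Y.left

/-- **Galois closure in `HolRS`.**  For every holomorphic finite étale `f : 𝕐 → 𝕏` of connected Riemann
surfaces there is an object `ℤ → 𝕏` of the slice whose underlying finite covering space of `𝕏^top` is
a GALOIS object of the Galois category `Cov^fin(𝕏^top)` (a normal = regular finite covering), together
with a morphism `ℤ → 𝕐` over `𝕏`.  (Mathlib's `exists_hom_from_galois_of_connected` in `Cov^fin(𝕏^top)`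
at the connected object `𝕐 → 𝕏`, lifted to the slice through abc-iut-L4-t12's «essential image of
`overToCovFin` = connected covers» and fullness.)
[cite: MochizukiAbsTopIII2015, proof of Proposition 4.2, p.106 l.11–19] [cite: SGA1, Exp. V §5] -/
theorem exists_galois_hom_over [GaloisCategory (CovFin X.carrier)] {Y : HolRS} (f : Y ⟶ X) :
    ∃ Z : Over X, IsGalois (X.overToCovFin.obj Z) ∧ Nonempty (Z ⟶ Over.mk f) := by
  haveI := pathConnectedSpace_carrier X
  haveI := stronglyLocallyContractibleSpace_carrier X
  haveI := X.overToCovFin_full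
  obtain ⟨x₀⟩ := (inferInstance : Nonempty X.carrier)
  let F := GaloisCategory.getFiberFunctor (CovFin X.carrier)
  haveI : IsConnected (X.overToCovFin.obj (Over.mk f)) := X.isConnected_overToCovFin_obj _
  obtain ⟨A, a, hA⟩ := exists_hom_from_galois_of_connected F (X.overToCovFin.obj (Over.mk f))
  haveI : PathConnectedSpace A.obj.left :=
    (CovFin.isConnected_iff_pathConnectedSpace x₀ A).mp hA.toIsConnected
  refine ⟨overOfCovFin A, isGalois_of_iso (overToCovFinObjIso A).symm, ⟨?_⟩⟩
  exact X.overToCovFin.preimage ((overToCovFinObjIso A).hom ≫ a)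

/-- **Galois closure with an epimorphism, in `HolRS` itself**: every `𝕐` mapping to `𝕏` receives a
morphism — automatically an EPIMORPHISM of `HolRS` — from a Riemann surface `ℤ` that is a Galois
(normal) finite étale covering of `𝕏`, compatibly with the maps to `𝕏`.
[cite: MochizukiAbsTopIII2015, proof of Proposition 4.2, p.106 l.11–19] [cite: SGA1, Exp. V §5] -/
theorem exists_galois_epi [GaloisCategory (CovFin X.carrier)] {Y : HolRS} (f : Y ⟶ X) :
    ∃ (Z : HolRS) (g : Z ⟶ X), IsGalois (X.overToCovFin.obj (Over.mk g)) ∧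
      ∃ h : Z ⟶ Y, h ≫ f = g ∧ Epi h := by
  obtain ⟨Z, hZ, ⟨k⟩⟩ := X.exists_galois_hom_over f
  exact ⟨Z.left, Z.hom, hZ, k.left, Over.w k, epi_of_hom _⟩

/-! ### §4 The epi-cover descent instantiated: «objects of `EA` mapping to `𝕏`» is id-rigid as soon as
the Galois coverings of `𝕏` span an id-rigid full subcategory -/

/-- **(Row «H1PRIME-HOLRS», descent form.)**  If the full subcategory of `HolRS` on the GALOIS finite
étale coverings of `𝕏` (objects `ℤ` admitting some `g : ℤ → 𝕏` whose underlying finite cover is a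
Galois object of `Cov^fin(𝕏^top)`) is id-rigid, then the full subcategory of objects mapping to `𝕏` is
id-rigid — abc-iut-w6-d003's `isIdRigid_mapsTo_of_epi_cover` with its covering hypothesis DISCHARGED by
the Galois closure (`exists_galois_epi`).  No hypothesis on `End 𝕏` / `Aut 𝕏`.
[cite: MochizukiAbsTopIII2015, Proposition 4.2 (i) p.106] -/
theorem isIdRigid_mapsTo_of_isIdRigid_galois [GaloisCategory (CovFin X.carrier)]
    (hT : IsIdRigid (ObjectProperty.FullSubcategory
      fun Z : HolRS => ∃ g : Z ⟶ X, IsGalois (X.overToCovFin.obj (Over.mk g)))) :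
    IsIdRigid (ObjectProperty.FullSubcategory fun Y : HolRS => Nonempty (Y ⟶ X)) :=
  isIdRigid_mapsTo_of_epi_cover X
    (P := fun Z : HolRS => ∃ g : Z ⟶ X, IsGalois (X.overToCovFin.obj (Over.mk g)))
    (fun _ hZ => hZ.elim fun g _ => ⟨g⟩) hT
    (fun Y hY => by
      obtain ⟨f⟩ := hY
      obtain ⟨Z, g, hZ, h, -, hh⟩ := X.exists_galois_epi f
      exact ⟨Z, ⟨g, hZ⟩, h, hh⟩)

/-! ### §5 The slice route at a connected Riemann surface: (H1′) + `Z(π̂₁(𝕏^top)) = 1` -/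

/-- **«Objects of `EA` mapping to `𝕏`» is id-rigid for a connected Riemann surface `𝕏` with centre-free
`π̂₁(𝕏^top, x₀)`, MODULO (H1′)**: every automorphism `σ` of `𝕏` whose pull-back on the slice `Over 𝕏`
is isomorphic to the identity functor is trivial.  ((H2) is abc-iut-L4-t12's
`isIdRigid_over_of_center_eq_bot`; (H1′) is what «`Aut(𝕏) → Out(π̂₁(𝕏^top))` injective» + abc-iut-L6-t18's
twisted natural families deliver for hyperbolic `𝕏` — NOT a consequence of the centre-freeness alone.)
[cite: MochizukiAbsTopIII2015, Proposition 4.2 (i) p.106] -/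
theorem isIdRigid_mapsTo_of_twist_of_center_eq_bot (x₀ : X.carrier)
    (hZ : Subgroup.center (profiniteCompletion (FundamentalGroup X.carrier x₀)) = ⊥)
    (h1' : ∀ σ : X ≅ X, Nonempty (Over.map σ.hom ≅ 𝟭 (Over X)) → σ.hom = 𝟙 X) :
    IsIdRigid (ObjectProperty.FullSubcategory fun Y : HolRS => Nonempty (Y ⟶ X)) :=
  isIdRigid_mapsTo_of_over_of_twist X (X.isIdRigid_over_of_center_eq_bot x₀ hZ) h1'

/-- The same with the slimness of `π̂₁(𝕏^top, x₀)` (print's Lemma 4.3 input) in place of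
centre-freeness. [cite: MochizukiAbsTopIII2015, Lemma 4.3 p.106] -/
theorem isIdRigid_mapsTo_of_twist_of_isSlimGroup (x₀ : X.carrier)
    (h : IsSlimGroup (profiniteCompletion (FundamentalGroup X.carrier x₀)))
    (h1' : ∀ σ : X ≅ X, Nonempty (Over.map σ.hom ≅ 𝟭 (Over X)) → σ.hom = 𝟙 X) :
    IsIdRigid (ObjectProperty.FullSubcategory fun Y : HolRS => Nonempty (Y ⟶ X)) :=
  isIdRigid_mapsTo_of_over_of_twist X (X.isIdRigid_over_of_isSlimGroup x₀ h) h1'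

end HolRS

end Literature.AnabelianGeometry.AbsoluteAnabelian
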